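import Mathlib.Data.Nat.Choose.Sum
import Literature.Barriers.ValiantsHypothesis.ShiftedPartialsCaseC2
import Mathlib.Tactic.Positivity
import Mathlib.Tactic.NormNum
import Mathlib.Tactic.Ring
import HarnessLib

/-!
# Cell qa-qnc0 (rung F-Q1, line `product`): elementary binomial / residue facts for `PLDAMSAllDensities`

Monotonicity of `C(n,·)` above the middle (the increasing half is the tree's
`Literature.Barriers.ValiantsHypothesis.choose_le_choose_of_le_half`), the crude large-deviation count
`3^s·Σ_{m ≥ s} C(n,m) ≤ 4ⁿ` (from `(3+1)ⁿ`), `2^{3⌊s/2⌋} ≤ 3^s`, the mod-3 bookkeeping of the inner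
partner layers `m ∓ q, m ∓ 2q`, and `#{a,b,c,e} ≤ 4`.  All folklore; split off to respect the
400-line bound on theorem files.
-/

namespace Summit.QuantumAdvantage.AdviceFreeQNC0

open Finset

/-! ### Binomial helper facts -/

/-- Above the middle the binomial coefficients decrease: `C(n,m) ≤ C(n,k)` for `n ≤ 2k`, `k ≤ m`.
[folklore] -/
theorem choose_le_choose_of_half_le {n k m : ℕ} (hk : n ≤ 2 * k) (hkm : k ≤ m) :
    n.choose m ≤ n.choose k := by
  by_cases hmn : m ≤ n
  · rw [← Nat.choose_symm hmn, ← Nat.choose_symm (hkm.trans hmn)]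
    exact Literature.Barriers.ValiantsHypothesis.choose_le_choose_of_le_half (by omega) (by omega)
  · rw [Nat.choose_eq_zero_of_lt (by omega)]; exact Nat.zero_le _

/-- `3^s · Σ_{m ≥ s} C(n,m) ≤ 4ⁿ`. [folklore] -/
theorem three_pow_mul_tail_le (n s : ℕ) :
    3 ^ s * ∑ m ∈ (range (n + 1)).filter (fun m => s ≤ m), n.choose m ≤ 4 ^ n := by
  have h4 : (4 : ℕ) ^ n = ∑ m ∈ range (n + 1), 3 ^ m * n.choose m := by
    have h := add_pow (3 : ℕ) 1 n
    simp only [one_pow, mul_one, Nat.cast_id] at h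
    exact h
  rw [h4, mul_sum, ← sum_filter_add_sum_filter_not (range (n + 1)) (fun m => s ≤ m)]
  refine le_trans (sum_le_sum fun m hm => ?_) (Nat.le_add_right _ _)
  exact Nat.mul_le_mul_right _ (Nat.pow_le_pow_right (by norm_num) (mem_filter.1 hm).2)

/-- `2^{3⌊s/2⌋} ≤ 3^s`. [folklore] -/
theorem two_pow_le_three_pow (s : ℕ) : 2 ^ (3 * (s / 2)) ≤ 3 ^ s := by
  have h1 : 2 ^ (3 * (s / 2)) = 8 ^ (s / 2) := by rw [pow_mul]; norm_num
  have h2 : (3 : ℕ) ^ s = 9 ^ (s / 2) * 3 ^ (s % 2) := by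
    conv_lhs => rw [← Nat.div_add_mod s 2]
    rw [pow_add, pow_mul]; norm_num
  rw [h1, h2]
  exact le_trans (Nat.pow_le_pow_left (by norm_num) _) (Nat.le_mul_of_pos_right _ (by positivity))

/-- `m, m − q, m − 2q` have distinct residues mod 3 when `3 ∤ q`. [folklore] -/
theorem mod3_partner_down {m q r : ℕ} (hq : q % 3 ≠ 0) (h2 : 2 * q ≤ m)
    (h1 : m % 3 ≠ r % 3) (h3 : (m - q) % 3 ≠ r % 3) : (m - 2 * q) % 3 = r % 3 := by
  obtain ⟨a, rfl⟩ : ∃ a, m = a + 2 * q := ⟨m - 2 * q, by omega⟩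
  rw [show a + 2 * q - q = a + q by omega] at h3
  rw [Nat.add_sub_cancel]
  have hq' : q % 3 = 1 ∨ q % 3 = 2 := by omega
  rcases hq' with hq' | hq' <;> omega

/-- `m, m + q, m + 2q` have distinct residues mod 3 when `3 ∤ q`. [folklore] -/
theorem mod3_partner_up {m q r : ℕ} (hq : q % 3 ≠ 0)
    (h1 : m % 3 ≠ r % 3) (h3 : (m + q) % 3 ≠ r % 3) : (m + 2 * q) % 3 = r % 3 := by
  have hq' : q % 3 = 1 ∨ q % 3 = 2 := by omega
  rcases hq' with hq' | hq' <;> omega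

/-- A four-element set has at most four elements. [folklore] -/
theorem card_quad_le (a b c e : ℕ) : ({a, b, c, e} : Finset ℕ).card ≤ 4 := by
  refine (card_insert_le _ _).trans (Nat.succ_le_succ ((card_insert_le _ _).trans
    (Nat.succ_le_succ ((card_insert_le _ _).trans ?_))))
  rw [card_singleton]


end Summit.QuantumAdvantage.AdviceFreeQNC0
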